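import Summits.QuantumFields.YangMills.Theorems.UnitScaleTiltProp7FrameRem2OfRegPrT3
import Summits.QuantumFields.YangMills.Theorems.UnitScaleTiltProp7CmapTwSJointRowXT3
import Summits.QuantumFields.YangMills.Theorems.UnitScaleTiltProp7PertVarCurrencyExchange
import Summits.QuantumFields.YangMills.Theorems.UnitScaleTiltProp7HDOfCombRowRem2RowsT3
import HarnessLib

/-!
# Route `UnitScaleTilt`, crux K1 «MinimiserStabilityRegPr» (stmt-QuantumFields-19200), route-R E′ (A′)-on-Σ, P-A2 row (β) of ✓p698006 — file «(β)-ASSEMBLY G3-s»: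
# **THE «REM2ˢ» ROW OF ✓p705268 `hD_of_hMcomb_of_rem2Rows` FROM THE «(n3)₂-sym» ROW** — px13 g6's member theorem ✓`Prop7FrameRem2OfRegPrT3.sum_norm_frameTwS_sub_one_sub_fderiv_le_of_regPr`
# (REM2ˢ ⟸ (n3) ✓, Φˢ-levels ✓, «(n3)₂-sym») packaged on the `hcoS`∕`hD` binder and read in `X`-currency.

Cell `ym3-torus` (HUMAN RULING D-0037: YM₃ on the torus is ladder rung R3 — not d = 4, not a mass gap, not Clay), width seat `ym3-torus-px16` (gen 5).  `--supports stmt-QuantumFields-19200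
--as helper`; THEOREMS ONLY (0 `def`, 0 `sorry`); count-neutral.

* ★★★ `hRs_of_hN2s (hN2s) : ⟨✓p705268's `hRs` row VERBATIM⟩` — per `(L, B₁′)`: radius `eS := min e₂ T⁻¹`, `T := 10¹⁴L⁹ + 4·10¹¹L⁹·(2B₁′)`; per member `ε₀ := e`, `σ := (4·10¹¹L⁹)⁻¹`,
  `s := σ·ℓ⁻¹`, `R l b := if l < K − n then ‖(n3)₂-summand‖ else 0`, `AR := A₂·M`, `BR := B₂·(K + DIV) + B₂′·(ℓ²)⁻¹·M`; then ★routeR-w4's exchange ✓`Prop7PertVarCurrencyExchange` and ★routeR-w3's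
  letter-free ✓`knit_arith` at `T := 1`, `r₁ := 2L`, `r₂ := 2∕L`.
DISPLAYED ROW (OPEN, route-internal, L; the plain symmetric tower's single-bar SECOND-ORDER linearisation remainders in ℓ¹ with two-slot level sums — the sym twin of «hMcomb₂»; px13 g6's `hR`∕`hRs`
summand TOKEN FOR TOKEN at `D := X`, summed per level, constants `A₂ B₂ B₂′` in `X`-letters):
`hN2s : ∀ L > 1, ∀ B₁′ > 0, ∃ e₂ A₂ B₂ B₂′, … ∀ ⟨hcoS∕hD binder⟩ → ∀ l < K − n, Σ_{b : PBond (F.P K) l} ‖pertVar Ūˡ[W] Ūˡ[e^{iX}W] b − D[Ū⁽ˡ⁾(e^{·}·W♭) b](0)(iX)·(Ūˡ[W] b)⋆‖ ≤ A₂·M·(Lˡ)⁻¹ + (B₂·(K+DIV) + B₂′·(ℓ²)⁻¹·M)·Lˡ`.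

HONEST SCOPE.  Bookkeeping; the displayed row is OPEN; nothing of REM2ˢ's analytic content, (β), hPA2, hcoS, E′, EX or the crux is proved here; YM₃ on T³ is rung R3 — NOT d = 4, NOT infinite volume,
NOT a mass gap, NOT Clay.
[cite: Balaban1985Variational, (2) p.278, (15) p.280, (19)-(20) p.281, (44)-(48) pp.285-286; Balaban1985Averaging, (82) p.30, (97) p.32, (122)-(126) p.36, (134)-(135) p.38; Balaban1985BackgroundPropagators,
(3.3)-(3.8) pp.391-392]
-/

noncomputable section

open scoped BigOperators Matrix.Norms.L2Operator Matrix Topology InnerProductSpace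
open Filter NormedSpace

namespace Summit.QuantumFields.YangMills.Theorems.Prop7SymFrameRem2RowOfN32Sym

open Literature.MathematicalPhysics.QuantumFieldTheory.Balaban1983to89
open Literature.MathematicalPhysics.QuantumFieldTheory.Balaban1983to89.T3ContinuumYM3Torus
open Literature.MathematicalPhysics.QuantumFieldTheory.Balaban1983to89.T3UnitLawDensityEML (ℰp)
open Literature.MathematicalPhysics.QuantumFieldTheory.Balaban1983to89.T3ConstrainedMinimiser (fibre)
open Literature.MathematicalPhysics.QuantumFieldTheory.Balaban1983to89.T3PrintedRegularMinimiser
open Literature.MathematicalPhysics.QuantumFieldTheory.Balaban1983to89.T3RegularMinimiser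
open Literature.MathematicalPhysics.QuantumFieldTheory.Balaban1983to89.T3Thm1Carrier
open T4Continuum T4ReflectionCone BlockAveraging AveragingRT ExpMeanLog BlockAveragingEMLLinearised BlockAveragingEMLLinearisedBackground BlockAveragingEMLProp2
open B7Prop1Explicit (expUnit val_expUnit)
open B10Eq27TorusAxialLog (pull unitsField toUField)
open B9Eq39Adjoint (curl divB)
open B9TorusCalculus (torusT)
open T3SectALandauChart (emb15 eta eta_pos bgUnits In19)
open B11Eq103H1Complex (BondL2K laplaceAK)
open Summit.QuantumFields.YangMills.Theorems.Prop8Chart (emlIterU)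
open Summit.QuantumFields.YangMills.Theorems.Prop7SPrint (basePt RestrictedPrint AvgCondPrint IsLandauPrint)
open Summit.QuantumFields.YangMills.Theorems.Prop7TPrint (expHermField)
open Summit.QuantumFields.YangMills.Theorems.Prop7SymAvgTwSym (frameTwS)
open Summit.QuantumFields.YangMills.Theorems.Prop7CmapTwSJointRowX (knit_arith)
open Summit.QuantumFields.YangMills.Theorems.Prop7PertVarCurrencyExchange (sum_normSq_pertVar_le curlHS_pertVar_le_plaqK divHS_pertVar_le)
open Summit.QuantumFields.YangMills.Theorems.Prop7TwistedLevelMassOfRegPr (plaq_le_of_regPr)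
open Summit.QuantumFields.YangMills.Theorems.Prop7Chart48SymUntwisted (unitsField_toUField_emb15_expHermField)
open Summit.QuantumFields.YangMills.Theorems.Prop7FrameRem2OfRegPrT3 (sum_norm_frameTwS_sub_one_sub_fderiv_le_of_regPr)
open Summit.QuantumFields.YangMills.Theorems.Prop7HcoSEndToEnd (summand_window)

variable (F : T3Family) (n K : ℕ)

/-! ## §1 Member level: REM2ˢ from the (n3)₂-sym level sums — (a) `M₀∕KD` currency, (b) `X` currency -/

/-- ★★ **(a) REM2ˢ FROM THE (n3)₂-sym LEVEL SUMS, `M₀∕KD` CURRENCY** — px13 g6 ✓`sum_norm_frameTwS_sub_one_sub_fderiv_le_of_regPr` at `ε₀ := e`, `s := σ·ℓ⁻¹`,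
`R l b := if l < K − n then ‖(n3)₂-summand‖ else 0`, `AR := A₂·M`, `BR := B₂·(K+DIV) + B₂′·(ℓ²)⁻¹·M` (the member-local (n3)₂-sym row `hN2` in `X`-letters, `l < K − n`; the top level of px13's
`hRs` is served by `R (K−n) := 0`). [cite: Balaban1985Averaging, (97) p.32, (122)-(126) p.36, (134)-(135) p.38; Balaban1985Variational, (19)-(20) p.281, (44)-(48) p.285] -/
theorem sum_norm_frameTwS_sub_one_sub_fderiv_le_of_N2 (h : n ≤ K) {e σ : ℝ} (he : 0 < e)
    (heL : 100000000000000 * (F.L : ℝ) ^ 9 * e ≤ 1) (hσ0 : 0 ≤ σ) (hσL : 400000000000 * (F.L : ℝ) ^ 9 * σ ≤ 1)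
    (W : GaugeField (F.P K) 0 (Matrix.specialUnitaryGroup (Fin 2) ℂ)) (hreg : RegPr F n K e W)
    (X : PBond (F.P K) 0 → Matrix (Fin 2) (Fin 2) ℂ) (hD : ∀ b : PBond (F.P K) 0, (X b).IsHermitian ∧ Matrix.trace (X b) = 0)
    (hs : ∀ b : PBond (F.P K) 0, ‖X b‖ ≤ σ * ((F.L : ℝ) ^ (K - n))⁻¹)
    {A₂ B₂ B₂' : ℝ} (hA₂ : 0 ≤ A₂) (hB₂ : 0 ≤ B₂) (hB₂' : 0 ≤ B₂')
    (hN2 : ∀ l : ℕ, l < K - n →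
            ∑ b : PBond (F.P K) l,
              ‖pertVar (Averaging.iter (fun i => blockAvg (P := (F.P K)) (j := i) (expMeanLogSU (n := Fin 2))) l W)
                (Averaging.iter (fun i => blockAvg (P := (F.P K)) (j := i) (expMeanLogSU (n := Fin 2))) l (emb15 W (expHermField X))) b
              - fderiv ℂ (fun t : PBond (F.P K) 0 → Matrix (Fin 2) (Fin 2) ℂ =>
                  ((emlIterU l (fun b' => expUnit (t b') * bgUnits F K W b') b : (Matrix (Fin 2) (Fin 2) ℂ)ˣ) : Matrix (Fin 2) (Fin 2) ℂ)) 0 (fun b' => Complex.I • X b')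
                * star ((Averaging.iter (fun i => blockAvg (P := (F.P K)) (j := i) (expMeanLogSU (n := Fin 2))) l W b : Matrix.specialUnitaryGroup (Fin 2) ℂ) : Matrix (Fin 2) (Fin 2) ℂ)‖
              ≤ A₂ * (∑ b : PBond (F.P K) 0, ‖X b‖ ^ 2) * ((F.L : ℝ) ^ l)⁻¹
                + (B₂ * ((∑ p : Plaq (F.P K) 0, ‖((Complex.I • X ⟨p.src, p.μ⟩) + ((W ⟨p.src, p.μ⟩ : Matrix (Fin 2) (Fin 2) ℂ) * (Complex.I • X ⟨p.src.shift p.μ, p.ν⟩) * star (W ⟨p.src, p.μ⟩ : Matrix (Fin 2) (Fin 2) ℂ))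
            - (((W ⟨p.src, p.μ⟩ * W ⟨p.src.shift p.μ, p.ν⟩ * (W ⟨p.src.shift p.ν, p.μ⟩)⁻¹ : Matrix.specialUnitaryGroup (Fin 2) ℂ) : Matrix (Fin 2) (Fin 2) ℂ) * (Complex.I • X ⟨p.src.shift p.ν, p.μ⟩) * star ((W ⟨p.src, p.μ⟩ * W ⟨p.src.shift p.μ, p.ν⟩ * (W ⟨p.src.shift p.ν, p.μ⟩)⁻¹ : Matrix.specialUnitaryGroup (Fin 2) ℂ) : Matrix (Fin 2) (Fin 2) ℂ))
            - (((GaugeField.plaqHol W p : Matrix.specialUnitaryGroup (Fin 2) ℂ) : Matrix (Fin 2) (Fin 2) ℂ) * (Complex.I • X ⟨p.src, p.ν⟩) * star ((GaugeField.plaqHol W p : Matrix.specialUnitaryGroup (Fin 2) ℂ) : Matrix (Fin 2) (Fin 2) ℂ)))‖ ^ 2) + (∑ x : Site (F.P K) 0, ∑ j : Fin 2, ∑ k : Fin 2,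
              ‖(divB (torusT (F.P K) 0) (fun κ z => unitsField (toUField W) ⟨z, κ⟩) (fun κ z => Complex.I • X ⟨z, κ⟩) x) j k‖ ^ 2))
                  + B₂' * (((F.L : ℝ) ^ (K - n)) ^ 2)⁻¹ * (∑ b : PBond (F.P K) 0, ‖X b‖ ^ 2)) * (F.L : ℝ) ^ l) :
    ∑ y : Site (F.P n) 0, ‖((frameTwS F n K h W (fun b => Complex.I • X b) y : (Matrix (Fin 2) (Fin 2) ℂ)ˣ) : Matrix (Fin 2) (Fin 2) ℂ) - 1
            - fderiv ℂ (fun A : PBond (F.P K) 0 → Matrix (Fin 2) (Fin 2) ℂ => ((frameTwS F n K h W A y : (Matrix (Fin 2) (Fin 2) ℂ)ˣ) : Matrix (Fin 2) (Fin 2) ℂ)) 0 (fun b => Complex.I • X b)‖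
      ≤ 2 * (F.L : ℝ) * ((9 * (F.L : ℝ) ^ 2 / 2 + 171 * (F.L : ℝ) ^ 2) * (7 * (∑ b : PBond (F.P K) 0, ‖pertVar W (emb15 W (expHermField X)) b‖ ^ 2))
          + 3 * (F.L : ℝ) / 2 * (A₂ * (∑ b : PBond (F.P K) 0, ‖X b‖ ^ 2))
          + 91 * (2 * (F.L : ℝ) * (40 * (F.L : ℝ) ^ 2) * (7 * (∑ b : PBond (F.P K) 0, ‖pertVar W (emb15 W (expHermField X)) b‖ ^ 2)))) * ((F.L : ℝ) ^ (K - n))⁻¹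
        + ((9 * (F.L : ℝ) ^ 2 / 2 + 171 * (F.L : ℝ) ^ 2) * (28800 * (F.L : ℝ) ^ 4 * ((∑ x : Site (F.P K) 0, ∑ μ : Fin (F.P K).d, ∑ ν : Fin (F.P K).d,
            (if μ < ν then ∑ j : Fin 2, ∑ k : Fin 2,
              ‖(curl (torusT (F.P K) 0) (fun κ z => unitsField (toUField W) ⟨z, κ⟩) (fun κ z => pertVar W (emb15 W (expHermField X)) ⟨z, κ⟩) μ ν x) j k‖ ^ 2 else 0)) + (∑ x : Site (F.P K) 0, ∑ j : Fin 2, ∑ k : Fin 2,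
            ‖(divB (torusT (F.P K) 0) (fun κ z => unitsField (toUField W) ⟨z, κ⟩) (fun κ z => pertVar W (emb15 W (expHermField X)) ⟨z, κ⟩) x) j k‖ ^ 2))
            + 600000 * (F.L : ℝ) ^ 4 * (((F.L : ℝ) ^ (K - n)) ^ 2)⁻¹ * (∑ b : PBond (F.P K) 0, ‖pertVar W (emb15 W (expHermField X)) b‖ ^ 2))
          + 3 * (F.L : ℝ) / 2 * (B₂ * ((∑ p : Plaq (F.P K) 0, ‖((Complex.I • X ⟨p.src, p.μ⟩) + ((W ⟨p.src, p.μ⟩ : Matrix (Fin 2) (Fin 2) ℂ) * (Complex.I • X ⟨p.src.shift p.μ, p.ν⟩) * star (W ⟨p.src, p.μ⟩ : Matrix (Fin 2) (Fin 2) ℂ))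
            - (((W ⟨p.src, p.μ⟩ * W ⟨p.src.shift p.μ, p.ν⟩ * (W ⟨p.src.shift p.ν, p.μ⟩)⁻¹ : Matrix.specialUnitaryGroup (Fin 2) ℂ) : Matrix (Fin 2) (Fin 2) ℂ) * (Complex.I • X ⟨p.src.shift p.ν, p.μ⟩) * star ((W ⟨p.src, p.μ⟩ * W ⟨p.src.shift p.μ, p.ν⟩ * (W ⟨p.src.shift p.ν, p.μ⟩)⁻¹ : Matrix.specialUnitaryGroup (Fin 2) ℂ) : Matrix (Fin 2) (Fin 2) ℂ))
            - (((GaugeField.plaqHol W p : Matrix.specialUnitaryGroup (Fin 2) ℂ) : Matrix (Fin 2) (Fin 2) ℂ) * (Complex.I • X ⟨p.src, p.ν⟩) * star ((GaugeField.plaqHol W p : Matrix.specialUnitaryGroup (Fin 2) ℂ) : Matrix (Fin 2) (Fin 2) ℂ)))‖ ^ 2) + (∑ x : Site (F.P K) 0, ∑ j : Fin 2, ∑ k : Fin 2,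
              ‖(divB (torusT (F.P K) 0) (fun κ z => unitsField (toUField W) ⟨z, κ⟩) (fun κ z => Complex.I • X ⟨z, κ⟩) x) j k‖ ^ 2))
                  + B₂' * (((F.L : ℝ) ^ (K - n)) ^ 2)⁻¹ * (∑ b : PBond (F.P K) 0, ‖X b‖ ^ 2))
          + 91 * (40 * (F.L : ℝ) ^ 2 * (28800 * (F.L : ℝ) ^ 4 * ((∑ x : Site (F.P K) 0, ∑ μ : Fin (F.P K).d, ∑ ν : Fin (F.P K).d,
            (if μ < ν then ∑ j : Fin 2, ∑ k : Fin 2,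
              ‖(curl (torusT (F.P K) 0) (fun κ z => unitsField (toUField W) ⟨z, κ⟩) (fun κ z => pertVar W (emb15 W (expHermField X)) ⟨z, κ⟩) μ ν x) j k‖ ^ 2 else 0)) + (∑ x : Site (F.P K) 0, ∑ j : Fin 2, ∑ k : Fin 2,
            ‖(divB (torusT (F.P K) 0) (fun κ z => unitsField (toUField W) ⟨z, κ⟩) (fun κ z => pertVar W (emb15 W (expHermField X)) ⟨z, κ⟩) x) j k‖ ^ 2))
            + 600000 * (F.L : ℝ) ^ 4 * (((F.L : ℝ) ^ (K - n)) ^ 2)⁻¹ * (∑ b : PBond (F.P K) 0, ‖pertVar W (emb15 W (expHermField X)) b‖ ^ 2)))) * (F.L : ℝ) ^ (K - n) := by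
  have hL3 : (3 : ℝ) ≤ F.L := Prop7CurvedLandauKnitT3.three_le_L F
  have hL1 : (1 : ℝ) ≤ F.L := by linarith
  have hℓ1 : (1 : ℝ) ≤ (F.L : ℝ) ^ (K - n) := one_le_pow₀ hL1
  have hℓ0 : (0 : ℝ) < (F.L : ℝ) ^ (K - n) := by positivity
  have hs0 : 0 ≤ σ * ((F.L : ℝ) ^ (K - n))⁻¹ := by positivity
  have hs4 : 4 * (σ * ((F.L : ℝ) ^ (K - n))⁻¹) ≤ 1 := by
    have hu1 : ((F.L : ℝ) ^ (K - n))⁻¹ ≤ 1 := inv_le_one_of_one_le₀ hℓ1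
    have h1 : σ * ((F.L : ℝ) ^ (K - n))⁻¹ ≤ σ := mul_le_of_le_one_right hσ0 hu1
    have h9' : (1 : ℝ) ≤ (F.L : ℝ) ^ 9 := one_le_pow₀ hL1
    have h2 : σ ≤ (F.L : ℝ) ^ 9 * σ := le_mul_of_one_le_left hσ0 h9'
    linarith only [h1, h2, hσL]
  have hsL : 400000000000 * (F.L : ℝ) ^ 9 * (((F.L : ℝ) ^ (K - n)) * (σ * ((F.L : ℝ) ^ (K - n))⁻¹)) ≤ 1 := by
    rw [show (F.L : ℝ) ^ (K - n) * (σ * ((F.L : ℝ) ^ (K - n))⁻¹) = σ by field_simp]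
    exact hσL
  have hM0 : 0 ≤ (∑ b : PBond (F.P K) 0, ‖X b‖ ^ 2) := Finset.sum_nonneg fun _ _ => sq_nonneg _
  have hKD0 : 0 ≤ ((∑ p : Plaq (F.P K) 0, ‖((Complex.I • X ⟨p.src, p.μ⟩) + ((W ⟨p.src, p.μ⟩ : Matrix (Fin 2) (Fin 2) ℂ) * (Complex.I • X ⟨p.src.shift p.μ, p.ν⟩) * star (W ⟨p.src, p.μ⟩ : Matrix (Fin 2) (Fin 2) ℂ))
            - (((W ⟨p.src, p.μ⟩ * W ⟨p.src.shift p.μ, p.ν⟩ * (W ⟨p.src.shift p.ν, p.μ⟩)⁻¹ : Matrix.specialUnitaryGroup (Fin 2) ℂ) : Matrix (Fin 2) (Fin 2) ℂ) * (Complex.I • X ⟨p.src.shift p.ν, p.μ⟩) * star ((W ⟨p.src, p.μ⟩ * W ⟨p.src.shift p.μ, p.ν⟩ * (W ⟨p.src.shift p.ν, p.μ⟩)⁻¹ : Matrix.specialUnitaryGroup (Fin 2) ℂ) : Matrix (Fin 2) (Fin 2) ℂ))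
            - (((GaugeField.plaqHol W p : Matrix.specialUnitaryGroup (Fin 2) ℂ) : Matrix (Fin 2) (Fin 2) ℂ) * (Complex.I • X ⟨p.src, p.ν⟩) * star ((GaugeField.plaqHol W p : Matrix.specialUnitaryGroup (Fin 2) ℂ) : Matrix (Fin 2) (Fin 2) ℂ)))‖ ^ 2) + (∑ x : Site (F.P K) 0, ∑ j : Fin 2, ∑ k : Fin 2,
              ‖(divB (torusT (F.P K) 0) (fun κ z => unitsField (toUField W) ⟨z, κ⟩) (fun κ z => Complex.I • X ⟨z, κ⟩) x) j k‖ ^ 2)) :=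
    add_nonneg (Finset.sum_nonneg fun _ _ => sq_nonneg _)
      (Finset.sum_nonneg fun _ _ => Finset.sum_nonneg fun _ _ => Finset.sum_nonneg fun _ _ => sq_nonneg _)
  obtain ⟨R, hR_def⟩ : ∃ R : (l : ℕ) → PBond (F.P K) l → ℝ, R = fun l b => if l < K - n then
              ‖pertVar (Averaging.iter (fun i => blockAvg (P := (F.P K)) (j := i) (expMeanLogSU (n := Fin 2))) l W)
                (Averaging.iter (fun i => blockAvg (P := (F.P K)) (j := i) (expMeanLogSU (n := Fin 2))) l (emb15 W (expHermField X))) b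
              - fderiv ℂ (fun t : PBond (F.P K) 0 → Matrix (Fin 2) (Fin 2) ℂ =>
                  ((emlIterU l (fun b' => expUnit (t b') * bgUnits F K W b') b : (Matrix (Fin 2) (Fin 2) ℂ)ˣ) : Matrix (Fin 2) (Fin 2) ℂ)) 0 (fun b' => Complex.I • X b')
                * star ((Averaging.iter (fun i => blockAvg (P := (F.P K)) (j := i) (expMeanLogSU (n := Fin 2))) l W b : Matrix.specialUnitaryGroup (Fin 2) ℂ) : Matrix (Fin 2) (Fin 2) ℂ)‖ else 0 := ⟨_, rfl⟩
  have hR0 : ∀ l b, 0 ≤ R l b := fun l b => by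
    rw [hR_def]; dsimp only
    split_ifs
    · exact norm_nonneg _
    · exact le_rfl
  have hR : ∀ l, l < K - n → ∀ b : PBond (F.P K) l,
      ‖pertVar (Averaging.iter (fun i => blockAvg (P := (F.P K)) (j := i) (expMeanLogSU (n := Fin 2))) l W)
                (Averaging.iter (fun i => blockAvg (P := (F.P K)) (j := i) (expMeanLogSU (n := Fin 2))) l (emb15 W (expHermField X))) b
              - fderiv ℂ (fun t : PBond (F.P K) 0 → Matrix (Fin 2) (Fin 2) ℂ =>
                  ((emlIterU l (fun b' => expUnit (t b') * bgUnits F K W b') b : (Matrix (Fin 2) (Fin 2) ℂ)ˣ) : Matrix (Fin 2) (Fin 2) ℂ)) 0 (fun b' => Complex.I • X b')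
                * star ((Averaging.iter (fun i => blockAvg (P := (F.P K)) (j := i) (expMeanLogSU (n := Fin 2))) l W b : Matrix.specialUnitaryGroup (Fin 2) ℂ) : Matrix (Fin 2) (Fin 2) ℂ)‖
        ≤ R l b := fun l hl b => by
    rw [hR_def]; dsimp only; rw [if_pos hl]
  have hAR : 0 ≤ A₂ * (∑ b : PBond (F.P K) 0, ‖X b‖ ^ 2) := mul_nonneg hA₂ hM0
  have hBR : 0 ≤ B₂ * ((∑ p : Plaq (F.P K) 0, ‖((Complex.I • X ⟨p.src, p.μ⟩) + ((W ⟨p.src, p.μ⟩ : Matrix (Fin 2) (Fin 2) ℂ) * (Complex.I • X ⟨p.src.shift p.μ, p.ν⟩) * star (W ⟨p.src, p.μ⟩ : Matrix (Fin 2) (Fin 2) ℂ))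
            - (((W ⟨p.src, p.μ⟩ * W ⟨p.src.shift p.μ, p.ν⟩ * (W ⟨p.src.shift p.ν, p.μ⟩)⁻¹ : Matrix.specialUnitaryGroup (Fin 2) ℂ) : Matrix (Fin 2) (Fin 2) ℂ) * (Complex.I • X ⟨p.src.shift p.ν, p.μ⟩) * star ((W ⟨p.src, p.μ⟩ * W ⟨p.src.shift p.μ, p.ν⟩ * (W ⟨p.src.shift p.ν, p.μ⟩)⁻¹ : Matrix.specialUnitaryGroup (Fin 2) ℂ) : Matrix (Fin 2) (Fin 2) ℂ))
            - (((GaugeField.plaqHol W p : Matrix.specialUnitaryGroup (Fin 2) ℂ) : Matrix (Fin 2) (Fin 2) ℂ) * (Complex.I • X ⟨p.src, p.ν⟩) * star ((GaugeField.plaqHol W p : Matrix.specialUnitaryGroup (Fin 2) ℂ) : Matrix (Fin 2) (Fin 2) ℂ)))‖ ^ 2) + (∑ x : Site (F.P K) 0, ∑ j : Fin 2, ∑ k : Fin 2,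
              ‖(divB (torusT (F.P K) 0) (fun κ z => unitsField (toUField W) ⟨z, κ⟩) (fun κ z => Complex.I • X ⟨z, κ⟩) x) j k‖ ^ 2))
                  + B₂' * (((F.L : ℝ) ^ (K - n)) ^ 2)⁻¹ * (∑ b : PBond (F.P K) 0, ‖X b‖ ^ 2) :=
    add_nonneg (mul_nonneg hB₂ hKD0) (mul_nonneg (mul_nonneg hB₂' (inv_nonneg.mpr (sq_nonneg _))) hM0)
  have hRs : ∀ l, l ≤ K - n → ∑ b : PBond (F.P K) l, R l b
      ≤ A₂ * (∑ b : PBond (F.P K) 0, ‖X b‖ ^ 2) * ((F.L : ℝ) ^ l)⁻¹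
        + (B₂ * ((∑ p : Plaq (F.P K) 0, ‖((Complex.I • X ⟨p.src, p.μ⟩) + ((W ⟨p.src, p.μ⟩ : Matrix (Fin 2) (Fin 2) ℂ) * (Complex.I • X ⟨p.src.shift p.μ, p.ν⟩) * star (W ⟨p.src, p.μ⟩ : Matrix (Fin 2) (Fin 2) ℂ))
            - (((W ⟨p.src, p.μ⟩ * W ⟨p.src.shift p.μ, p.ν⟩ * (W ⟨p.src.shift p.ν, p.μ⟩)⁻¹ : Matrix.specialUnitaryGroup (Fin 2) ℂ) : Matrix (Fin 2) (Fin 2) ℂ) * (Complex.I • X ⟨p.src.shift p.ν, p.μ⟩) * star ((W ⟨p.src, p.μ⟩ * W ⟨p.src.shift p.μ, p.ν⟩ * (W ⟨p.src.shift p.ν, p.μ⟩)⁻¹ : Matrix.specialUnitaryGroup (Fin 2) ℂ) : Matrix (Fin 2) (Fin 2) ℂ))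
            - (((GaugeField.plaqHol W p : Matrix.specialUnitaryGroup (Fin 2) ℂ) : Matrix (Fin 2) (Fin 2) ℂ) * (Complex.I • X ⟨p.src, p.ν⟩) * star ((GaugeField.plaqHol W p : Matrix.specialUnitaryGroup (Fin 2) ℂ) : Matrix (Fin 2) (Fin 2) ℂ)))‖ ^ 2) + (∑ x : Site (F.P K) 0, ∑ j : Fin 2, ∑ k : Fin 2,
              ‖(divB (torusT (F.P K) 0) (fun κ z => unitsField (toUField W) ⟨z, κ⟩) (fun κ z => Complex.I • X ⟨z, κ⟩) x) j k‖ ^ 2))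
          + B₂' * (((F.L : ℝ) ^ (K - n)) ^ 2)⁻¹ * (∑ b : PBond (F.P K) 0, ‖X b‖ ^ 2)) * (F.L : ℝ) ^ l := by
    intro l hl
    rcases Nat.lt_or_eq_of_le hl with hlt | heq
    · have hre : ∑ b : PBond (F.P K) l, R l b = ∑ b : PBond (F.P K) l,
          ‖pertVar (Averaging.iter (fun i => blockAvg (P := (F.P K)) (j := i) (expMeanLogSU (n := Fin 2))) l W)
                (Averaging.iter (fun i => blockAvg (P := (F.P K)) (j := i) (expMeanLogSU (n := Fin 2))) l (emb15 W (expHermField X))) b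
              - fderiv ℂ (fun t : PBond (F.P K) 0 → Matrix (Fin 2) (Fin 2) ℂ =>
                  ((emlIterU l (fun b' => expUnit (t b') * bgUnits F K W b') b : (Matrix (Fin 2) (Fin 2) ℂ)ˣ) : Matrix (Fin 2) (Fin 2) ℂ)) 0 (fun b' => Complex.I • X b')
                * star ((Averaging.iter (fun i => blockAvg (P := (F.P K)) (j := i) (expMeanLogSU (n := Fin 2))) l W b : Matrix.specialUnitaryGroup (Fin 2) ℂ) : Matrix (Fin 2) (Fin 2) ℂ)‖ := by
        refine Finset.sum_congr rfl fun b _ => ?_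
        rw [hR_def]; dsimp only; rw [if_pos hlt]
      rw [hre]; exact hN2 l hlt
    · have hre : ∑ b : PBond (F.P K) l, R l b = 0 := by
        refine Finset.sum_eq_zero fun b _ => ?_
        rw [hR_def]; dsimp only; rw [if_neg (by omega)]
      rw [hre]; positivity
  exact sum_norm_frameTwS_sub_one_sub_fderiv_le_of_regPr (F := F) h he heL hs0 hs4 hsL hreg X hD hs R hR0 hR hAR hBR hRs

set_option maxHeartbeats 400000 in
-- HEARTBEAT rule (README): as in ✓p701274∕✓p704590 — `knit_arith`'s 30-argument instantiation against the JOINT plaquette form and the (n3) mass blocks measures > 200k.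
/-- ★★ **(b) THE SAME IN `X`-CURRENCY**: `Σ_y ‖w^s_y(iX) − 1 − Dw^s_y(0)(iX)‖ ≤ Cs₁″(L,σ,A₂,B₂′)·ℓ⁻¹·M + Cs₂″(L,B₂)·ℓ·(K_W(iX) + DIV_W(iX))` — (a) read through ★routeR-w4's exchange
✓`Prop7PertVarCurrencyExchange` and ★routeR-w3's letter-free ✓`knit_arith` (`T := 1`, `r₁ := 2L`, `r₂ := 2∕L`), the `AR`∕`BR` terms set aside.
[cite: Balaban1985Variational, (15) p.280, (19)-(20) p.281, (44)-(48) pp.285-286; Balaban1985BackgroundPropagators, (3.3)-(3.8) pp.391-392; Balaban1985Averaging, (97) p.32] -/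
theorem sum_norm_frameTwS_sub_one_sub_fderiv_le_X_of_N2 (h : n ≤ K) {e σ : ℝ} (he : 0 < e)
    (heL : 100000000000000 * (F.L : ℝ) ^ 9 * e ≤ 1) (hσ0 : 0 ≤ σ) (hσL : 400000000000 * (F.L : ℝ) ^ 9 * σ ≤ 1)
    (W : GaugeField (F.P K) 0 (Matrix.specialUnitaryGroup (Fin 2) ℂ)) (hreg : RegPr F n K e W)
    (X : PBond (F.P K) 0 → Matrix (Fin 2) (Fin 2) ℂ) (hD : ∀ b : PBond (F.P K) 0, (X b).IsHermitian ∧ Matrix.trace (X b) = 0)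
    (hs : ∀ b : PBond (F.P K) 0, ‖X b‖ ≤ σ * ((F.L : ℝ) ^ (K - n))⁻¹)
    {A₂ B₂ B₂' : ℝ} (hA₂ : 0 ≤ A₂) (hB₂ : 0 ≤ B₂) (hB₂' : 0 ≤ B₂')
    (hN2 : ∀ l : ℕ, l < K - n →
            ∑ b : PBond (F.P K) l,
              ‖pertVar (Averaging.iter (fun i => blockAvg (P := (F.P K)) (j := i) (expMeanLogSU (n := Fin 2))) l W)
                (Averaging.iter (fun i => blockAvg (P := (F.P K)) (j := i) (expMeanLogSU (n := Fin 2))) l (emb15 W (expHermField X))) b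
              - fderiv ℂ (fun t : PBond (F.P K) 0 → Matrix (Fin 2) (Fin 2) ℂ =>
                  ((emlIterU l (fun b' => expUnit (t b') * bgUnits F K W b') b : (Matrix (Fin 2) (Fin 2) ℂ)ˣ) : Matrix (Fin 2) (Fin 2) ℂ)) 0 (fun b' => Complex.I • X b')
                * star ((Averaging.iter (fun i => blockAvg (P := (F.P K)) (j := i) (expMeanLogSU (n := Fin 2))) l W b : Matrix.specialUnitaryGroup (Fin 2) ℂ) : Matrix (Fin 2) (Fin 2) ℂ)‖
              ≤ A₂ * (∑ b : PBond (F.P K) 0, ‖X b‖ ^ 2) * ((F.L : ℝ) ^ l)⁻¹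
                + (B₂ * ((∑ p : Plaq (F.P K) 0, ‖((Complex.I • X ⟨p.src, p.μ⟩) + ((W ⟨p.src, p.μ⟩ : Matrix (Fin 2) (Fin 2) ℂ) * (Complex.I • X ⟨p.src.shift p.μ, p.ν⟩) * star (W ⟨p.src, p.μ⟩ : Matrix (Fin 2) (Fin 2) ℂ))
            - (((W ⟨p.src, p.μ⟩ * W ⟨p.src.shift p.μ, p.ν⟩ * (W ⟨p.src.shift p.ν, p.μ⟩)⁻¹ : Matrix.specialUnitaryGroup (Fin 2) ℂ) : Matrix (Fin 2) (Fin 2) ℂ) * (Complex.I • X ⟨p.src.shift p.ν, p.μ⟩) * star ((W ⟨p.src, p.μ⟩ * W ⟨p.src.shift p.μ, p.ν⟩ * (W ⟨p.src.shift p.ν, p.μ⟩)⁻¹ : Matrix.specialUnitaryGroup (Fin 2) ℂ) : Matrix (Fin 2) (Fin 2) ℂ))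
            - (((GaugeField.plaqHol W p : Matrix.specialUnitaryGroup (Fin 2) ℂ) : Matrix (Fin 2) (Fin 2) ℂ) * (Complex.I • X ⟨p.src, p.ν⟩) * star ((GaugeField.plaqHol W p : Matrix.specialUnitaryGroup (Fin 2) ℂ) : Matrix (Fin 2) (Fin 2) ℂ)))‖ ^ 2) + (∑ x : Site (F.P K) 0, ∑ j : Fin 2, ∑ k : Fin 2,
              ‖(divB (torusT (F.P K) 0) (fun κ z => unitsField (toUField W) ⟨z, κ⟩) (fun κ z => Complex.I • X ⟨z, κ⟩) x) j k‖ ^ 2))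
                  + B₂' * (((F.L : ℝ) ^ (K - n)) ^ 2)⁻¹ * (∑ b : PBond (F.P K) 0, ‖X b‖ ^ 2)) * (F.L : ℝ) ^ l) :
    ∑ y : Site (F.P n) 0, ‖((frameTwS F n K h W (fun b => Complex.I • X b) y : (Matrix (Fin 2) (Fin 2) ℂ)ˣ) : Matrix (Fin 2) (Fin 2) ℂ) - 1
            - fderiv ℂ (fun A : PBond (F.P K) 0 → Matrix (Fin 2) (Fin 2) ℂ => ((frameTwS F n K h W A y : (Matrix (Fin 2) (Fin 2) ℂ)ˣ) : Matrix (Fin 2) (Fin 2) ℂ)) 0 (fun b => Complex.I • X b)‖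
      ≤ ((1 * (2 * (F.L : ℝ) * (7 * (9 * (F.L : ℝ) ^ 2 / 2 + 171 * (F.L : ℝ) ^ 2) + 50960 * (F.L : ℝ) ^ 3) + 2 / (F.L : ℝ) * ((((9 * (F.L : ℝ) ^ 2 / 2 + 171 * (F.L : ℝ) ^ 2) + 3640 * (F.L : ℝ) ^ 2) * (28800 * (F.L : ℝ) ^ 4) * ((F.L : ℝ) / 2)) * (384 + 60 * σ ^ 2) + (((9 * (F.L : ℝ) ^ 2 / 2 + 171 * (F.L : ℝ) ^ 2) + 3640 * (F.L : ℝ) ^ 2) * (600000 * (F.L : ℝ) ^ 4) * ((F.L : ℝ) / 2))))) + 3 * (F.L : ℝ) ^ 2 * A₂ + 3 * (F.L : ℝ) / 2 * B₂') * ((F.L : ℝ) ^ (K - n))⁻¹ * (∑ b : PBond (F.P K) 0, ‖X b‖ ^ 2)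
        + ((1 * (2 / (F.L : ℝ) * (8 * (((9 * (F.L : ℝ) ^ 2 / 2 + 171 * (F.L : ℝ) ^ 2) + 3640 * (F.L : ℝ) ^ 2) * (28800 * (F.L : ℝ) ^ 4) * ((F.L : ℝ) / 2))))) + 3 * (F.L : ℝ) / 2 * B₂) * ((F.L : ℝ) ^ (K - n)) * ((∑ p : Plaq (F.P K) 0, ‖((Complex.I • X ⟨p.src, p.μ⟩) + ((W ⟨p.src, p.μ⟩ : Matrix (Fin 2) (Fin 2) ℂ) * (Complex.I • X ⟨p.src.shift p.μ, p.ν⟩) * star (W ⟨p.src, p.μ⟩ : Matrix (Fin 2) (Fin 2) ℂ))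
            - (((W ⟨p.src, p.μ⟩ * W ⟨p.src.shift p.μ, p.ν⟩ * (W ⟨p.src.shift p.ν, p.μ⟩)⁻¹ : Matrix.specialUnitaryGroup (Fin 2) ℂ) : Matrix (Fin 2) (Fin 2) ℂ) * (Complex.I • X ⟨p.src.shift p.ν, p.μ⟩) * star ((W ⟨p.src, p.μ⟩ * W ⟨p.src.shift p.μ, p.ν⟩ * (W ⟨p.src.shift p.ν, p.μ⟩)⁻¹ : Matrix.specialUnitaryGroup (Fin 2) ℂ) : Matrix (Fin 2) (Fin 2) ℂ))
            - (((GaugeField.plaqHol W p : Matrix.specialUnitaryGroup (Fin 2) ℂ) : Matrix (Fin 2) (Fin 2) ℂ) * (Complex.I • X ⟨p.src, p.ν⟩) * star ((GaugeField.plaqHol W p : Matrix.specialUnitaryGroup (Fin 2) ℂ) : Matrix (Fin 2) (Fin 2) ℂ)))‖ ^ 2) + (∑ x : Site (F.P K) 0, ∑ j : Fin 2, ∑ k : Fin 2,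
              ‖(divB (torusT (F.P K) 0) (fun κ z => unitsField (toUField W) ⟨z, κ⟩) (fun κ z => Complex.I • X ⟨z, κ⟩) x) j k‖ ^ 2)) := by
  have hL3 : (3 : ℝ) ≤ F.L := Prop7CurvedLandauKnitT3.three_le_L F
  have hL0 : (0 : ℝ) < F.L := by linarith
  have hL1 : (1 : ℝ) ≤ F.L := by linarith
  have hℓ1 : (1 : ℝ) ≤ (F.L : ℝ) ^ (K - n) := one_le_pow₀ hL1
  have hℓ0 : (0 : ℝ) < (F.L : ℝ) ^ (K - n) := by positivity
  have hmem := sum_norm_frameTwS_sub_one_sub_fderiv_le_of_N2 F n K h he heL hσ0 hσL W hreg X hD hs hA₂ hB₂ hB₂' hN2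
  -- the currency exchange (★routeR-w4)
  have hcomp := unitsField_toUField_emb15_expHermField F W X hD
  have hU : ∀ b : PBond (F.P K) 0, ((emb15 W (expHermField X) b : Matrix.specialUnitaryGroup (Fin 2) ℂ) : Matrix (Fin 2) (Fin 2) ℂ) =
      exp (Complex.I • X b) * ((W b : Matrix.specialUnitaryGroup (Fin 2) ℂ) : Matrix (Fin 2) (Fin 2) ℂ) := by
    intro b
    have h1 := congrArg (fun u : (Matrix (Fin 2) (Fin 2) ℂ)ˣ => (u : Matrix (Fin 2) (Fin 2) ℂ)) (congrFun hcomp b)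
    simp only [Units.val_mul, val_expUnit] at h1
    exact h1
  have hX : ∀ b : PBond (F.P K) 0, (X b).IsHermitian := fun b => (hD b).1
  have hM₀ := sum_normSq_pertVar_le W (emb15 W (expHermField X)) X hX hU
  have ha := plaq_le_of_regPr F n K hreg
  have hCU := curlHS_pertVar_le_plaqK W (emb15 W (expHermField X)) X hX hU hs ha
  have hDV := divHS_pertVar_le W (emb15 W (expHermField X)) X hX hU hs
  have he1 : e ≤ 1 := by
    have h9' : (1 : ℝ) ≤ (F.L : ℝ) ^ 9 := one_le_pow₀ hL1
    have : e ≤ (F.L : ℝ) ^ 9 * e := le_mul_of_one_le_left he.le h9'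
    linarith only [this, heL, he.le]
  have hd : ((F.P K).d : ℝ) = 3 := by rw [T3Family.P_d F K]; norm_num
  have hCU0 : 0 ≤ ∑ x : Site (F.P K) 0, ∑ μ : Fin (F.P K).d, ∑ ν : Fin (F.P K).d,
      (if μ < ν then ∑ j : Fin 2, ∑ k : Fin 2,
        ‖(curl (torusT (F.P K) 0) (fun κ z => unitsField (toUField W) ⟨z, κ⟩) (fun κ z => pertVar W (emb15 W (expHermField X)) ⟨z, κ⟩) μ ν x) j k‖ ^ 2 else 0) := by
    refine Finset.sum_nonneg fun x _ => Finset.sum_nonneg fun μ _ => Finset.sum_nonneg fun ν _ => ?_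
    split_ifs
    · positivity
    · exact le_rfl
  have hM0 : 0 ≤ (∑ b : PBond (F.P K) 0, ‖X b‖ ^ 2) := Finset.sum_nonneg fun _ _ => sq_nonneg _
  have hM₀0 : 0 ≤ (∑ b : PBond (F.P K) 0, ‖pertVar W (emb15 W (expHermField X)) b‖ ^ 2) := Finset.sum_nonneg fun _ _ => sq_nonneg _
  have hDV0 : 0 ≤ (∑ x : Site (F.P K) 0, ∑ j : Fin 2, ∑ k : Fin 2,
            ‖(divB (torusT (F.P K) 0) (fun κ z => unitsField (toUField W) ⟨z, κ⟩) (fun κ z => pertVar W (emb15 W (expHermField X)) ⟨z, κ⟩) x) j k‖ ^ 2) :=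
    Finset.sum_nonneg fun _ _ => Finset.sum_nonneg fun _ _ => Finset.sum_nonneg fun _ _ => sq_nonneg _
  have hKp0 : 0 ≤ (∑ p : Plaq (F.P K) 0, ‖((Complex.I • X ⟨p.src, p.μ⟩) + ((W ⟨p.src, p.μ⟩ : Matrix (Fin 2) (Fin 2) ℂ) * (Complex.I • X ⟨p.src.shift p.μ, p.ν⟩) * star (W ⟨p.src, p.μ⟩ : Matrix (Fin 2) (Fin 2) ℂ))
            - (((W ⟨p.src, p.μ⟩ * W ⟨p.src.shift p.μ, p.ν⟩ * (W ⟨p.src.shift p.ν, p.μ⟩)⁻¹ : Matrix.specialUnitaryGroup (Fin 2) ℂ) : Matrix (Fin 2) (Fin 2) ℂ) * (Complex.I • X ⟨p.src.shift p.ν, p.μ⟩) * star ((W ⟨p.src, p.μ⟩ * W ⟨p.src.shift p.μ, p.ν⟩ * (W ⟨p.src.shift p.ν, p.μ⟩)⁻¹ : Matrix.specialUnitaryGroup (Fin 2) ℂ) : Matrix (Fin 2) (Fin 2) ℂ))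
            - (((GaugeField.plaqHol W p : Matrix.specialUnitaryGroup (Fin 2) ℂ) : Matrix (Fin 2) (Fin 2) ℂ) * (Complex.I • X ⟨p.src, p.ν⟩) * star ((GaugeField.plaqHol W p : Matrix.specialUnitaryGroup (Fin 2) ℂ) : Matrix (Fin 2) (Fin 2) ℂ)))‖ ^ 2) := Finset.sum_nonneg fun _ _ => sq_nonneg _
  have hDX0 : 0 ≤ (∑ x : Site (F.P K) 0, ∑ j : Fin 2, ∑ k : Fin 2,
              ‖(divB (torusT (F.P K) 0) (fun κ z => unitsField (toUField W) ⟨z, κ⟩) (fun κ z => Complex.I • X ⟨z, κ⟩) x) j k‖ ^ 2) :=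
    Finset.sum_nonneg fun _ _ => Finset.sum_nonneg fun _ _ => Finset.sum_nonneg fun _ _ => sq_nonneg _
  -- px13's mass block rewritten in `knit_arith`'s shape (`T := 1`, `r₁ := 2L`, `r₂ := 2∕L`), the `AR`∕`BR` terms set aside
  have hshape : ∀ (M₀ KD Λ AR BR : ℝ),
      Λ ≤ 2 * (F.L : ℝ) * ((9 * (F.L : ℝ) ^ 2 / 2 + 171 * (F.L : ℝ) ^ 2) * (7 * M₀)
          + 3 * (F.L : ℝ) / 2 * AR
          + 91 * (2 * (F.L : ℝ) * (40 * (F.L : ℝ) ^ 2) * (7 * M₀))) * ((F.L : ℝ) ^ (K - n))⁻¹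
        + ((9 * (F.L : ℝ) ^ 2 / 2 + 171 * (F.L : ℝ) ^ 2) * (28800 * (F.L : ℝ) ^ 4 * KD
            + 600000 * (F.L : ℝ) ^ 4 * (((F.L : ℝ) ^ (K - n)) ^ 2)⁻¹ * M₀)
          + 3 * (F.L : ℝ) / 2 * BR
          + 91 * (40 * (F.L : ℝ) ^ 2 * (28800 * (F.L : ℝ) ^ 4 * KD
            + 600000 * (F.L : ℝ) ^ 4 * (((F.L : ℝ) ^ (K - n)) ^ 2)⁻¹ * M₀))) * (F.L : ℝ) ^ (K - n) →
      Λ - (2 * (F.L : ℝ) * (3 * (F.L : ℝ) / 2 * AR) * ((F.L : ℝ) ^ (K - n))⁻¹ + 3 * (F.L : ℝ) / 2 * BR * (F.L : ℝ) ^ (K - n))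
        ≤ 1 * ((7 * (9 * (F.L : ℝ) ^ 2 / 2 + 171 * (F.L : ℝ) ^ 2) + 50960 * (F.L : ℝ) ^ 3) * M₀ * (2 * (F.L : ℝ)) * ((F.L : ℝ) ^ (K - n))⁻¹
          + ((((9 * (F.L : ℝ) ^ 2 / 2 + 171 * (F.L : ℝ) ^ 2) + 3640 * (F.L : ℝ) ^ 2) * (28800 * (F.L : ℝ) ^ 4) * ((F.L : ℝ) / 2)) * KD
              + (((9 * (F.L : ℝ) ^ 2 / 2 + 171 * (F.L : ℝ) ^ 2) + 3640 * (F.L : ℝ) ^ 2) * (600000 * (F.L : ℝ) ^ 4) * ((F.L : ℝ) / 2)) * 1 * (((F.L : ℝ) ^ (K - n)) ^ 2)⁻¹ * M₀)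
            * (2 / (F.L : ℝ)) * (F.L : ℝ) ^ (K - n)) := by
    intro M₀ KD Λ AR BR hΛ
    have e : 2 * (F.L : ℝ) * ((9 * (F.L : ℝ) ^ 2 / 2 + 171 * (F.L : ℝ) ^ 2) * (7 * M₀)
          + 3 * (F.L : ℝ) / 2 * AR
          + 91 * (2 * (F.L : ℝ) * (40 * (F.L : ℝ) ^ 2) * (7 * M₀))) * ((F.L : ℝ) ^ (K - n))⁻¹
        + ((9 * (F.L : ℝ) ^ 2 / 2 + 171 * (F.L : ℝ) ^ 2) * (28800 * (F.L : ℝ) ^ 4 * KD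
            + 600000 * (F.L : ℝ) ^ 4 * (((F.L : ℝ) ^ (K - n)) ^ 2)⁻¹ * M₀)
          + 3 * (F.L : ℝ) / 2 * BR
          + 91 * (40 * (F.L : ℝ) ^ 2 * (28800 * (F.L : ℝ) ^ 4 * KD
            + 600000 * (F.L : ℝ) ^ 4 * (((F.L : ℝ) ^ (K - n)) ^ 2)⁻¹ * M₀))) * (F.L : ℝ) ^ (K - n)
        - (2 * (F.L : ℝ) * (3 * (F.L : ℝ) / 2 * AR) * ((F.L : ℝ) ^ (K - n))⁻¹ + 3 * (F.L : ℝ) / 2 * BR * (F.L : ℝ) ^ (K - n))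
      = 1 * ((7 * (9 * (F.L : ℝ) ^ 2 / 2 + 171 * (F.L : ℝ) ^ 2) + 50960 * (F.L : ℝ) ^ 3) * M₀ * (2 * (F.L : ℝ)) * ((F.L : ℝ) ^ (K - n))⁻¹
          + ((((9 * (F.L : ℝ) ^ 2 / 2 + 171 * (F.L : ℝ) ^ 2) + 3640 * (F.L : ℝ) ^ 2) * (28800 * (F.L : ℝ) ^ 4) * ((F.L : ℝ) / 2)) * KD
              + (((9 * (F.L : ℝ) ^ 2 / 2 + 171 * (F.L : ℝ) ^ 2) + 3640 * (F.L : ℝ) ^ 2) * (600000 * (F.L : ℝ) ^ 4) * ((F.L : ℝ) / 2)) * 1 * (((F.L : ℝ) ^ (K - n)) ^ 2)⁻¹ * M₀)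
            * (2 / (F.L : ℝ)) * (F.L : ℝ) ^ (K - n)) := by
      field_simp
      ring
    linarith [hΛ, e.le, e.ge]
  have hS := hshape _ _ _ _ _ hmem
  have hr₂0 : (0 : ℝ) ≤ 2 / (F.L : ℝ) := by positivity
  have hr₁0 : (0 : ℝ) ≤ 2 * (F.L : ℝ) := by positivity
  have hk := knit_arith (T := 1) (r₁ := 2 * (F.L : ℝ)) (r₂ := 2 / (F.L : ℝ))
    hL3 hℓ0 hℓ1 rfl (by norm_num) he.le he1 hM0 hM₀0 hM₀
    hKp0 hDX0 (by positivity) (by positivity) (by positivity) hr₁0 le_rfl hr₂0 le_rfl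
    (by norm_num : ((2 : ℕ) : ℝ) = 2) hd (by rw [inv_pow]) rfl hCU0 hCU hDV0 hDV hS
  -- collect: `(ℓ²)⁻¹·M·ℓ = ℓ⁻¹·M`
  have hinv : (((F.L : ℝ) ^ (K - n)) ^ 2)⁻¹ * (F.L : ℝ) ^ (K - n) = ((F.L : ℝ) ^ (K - n))⁻¹ := by
    rw [pow_two, mul_inv, mul_assoc, inv_mul_cancel₀ hℓ0.ne', mul_one]
  have e4 : 3 * (F.L : ℝ) / 2 * (B₂' * (((F.L : ℝ) ^ (K - n)) ^ 2)⁻¹ * (∑ b : PBond (F.P K) 0, ‖X b‖ ^ 2)) * (F.L : ℝ) ^ (K - n)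
      = 3 * (F.L : ℝ) / 2 * B₂' * ((F.L : ℝ) ^ (K - n))⁻¹ * (∑ b : PBond (F.P K) 0, ‖X b‖ ^ 2) := by
    rw [← hinv]; ring
  linarith only [hk, e4]

/-! ## §2 The binder packaging: ✓p705268's `hRs` row from the displayed «(n3)₂-sym» row -/

/-- ★★★ **THE «REM2ˢ» ROW FROM THE «(n3)₂-sym» ROW** — conclusion = ✓p705268 `hD_of_hMcomb_of_rem2Rows`'s hypothesis `hRs` VERBATIM; hypothesis = the displayed OPEN row `hN2s` (docstring above).
Radius `eS := min e₂ T⁻¹`, `T := 10¹⁴L⁹ + 4·10¹¹L⁹·(2B₁′)`; per member `ε₀ := e`, `σ := (4·10¹¹L⁹)⁻¹` (★p1's `hS_holds` template), then §1(b).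
[cite: Balaban1985Variational, (2) p.278, (19)-(20) p.281, (44)-(48) pp.285-286; Balaban1985Averaging, (97) p.32, (122)-(126) p.36] -/
theorem hRs_of_hN2s
    (hN2s : ∀ (L : ℕ), 1 < L → ∀ (B₁' : ℝ), 0 < B₁' → ∃ e₂ A₂ B₂ B₂' : ℝ, 0 < e₂ ∧ 0 ≤ A₂ ∧ 0 ≤ B₂ ∧ 0 ≤ B₂' ∧
      ∀ (F : T3Family), F.L = L → ∀ (n K : ℕ) (hnK : n < K) (e : ℝ) (V : GaugeField (F.P n) 0 (Matrix.specialUnitaryGroup (Fin 2) ℂ))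
        (W : GaugeField (F.P K) 0 (Matrix.specialUnitaryGroup (Fin 2) ℂ)) (X : PBond (F.P K) 0 → Matrix (Fin 2) (Fin 2) ℂ),
        0 < e → e ≤ e₂ → W ∈ regFibrePr F n K hnK.le e V →
        (∀ γ : ℝ → GaugeField (F.P K) 0 (Matrix.specialUnitaryGroup (Fin 2) ℂ), γ 0 = W → (∀ t, γ t ∈ fibre F ℰp n K hnK.le V) →
          (∀ b, DifferentiableAt ℝ (fun t => ((γ t b : Matrix.specialUnitaryGroup (Fin 2) ℂ) : Matrix (Fin 2) (Fin 2) ℂ)) 0) →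
            deriv (fun t => wilsonAction4 (γ t)) 0 = 0) →
        In19 F n K (2 * B₁' * e) W (expHermField X) X → AvgCondPrint F n K hnK.le V W X → IsLandauPrint F n K W X →
          ∀ l : ℕ, l < K - n →
            ∑ b : PBond (F.P K) l,
              ‖pertVar (Averaging.iter (fun i => blockAvg (P := (F.P K)) (j := i) (expMeanLogSU (n := Fin 2))) l W)
                (Averaging.iter (fun i => blockAvg (P := (F.P K)) (j := i) (expMeanLogSU (n := Fin 2))) l (emb15 W (expHermField X))) b
              - fderiv ℂ (fun t : PBond (F.P K) 0 → Matrix (Fin 2) (Fin 2) ℂ =>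
                  ((emlIterU l (fun b' => expUnit (t b') * bgUnits F K W b') b : (Matrix (Fin 2) (Fin 2) ℂ)ˣ) : Matrix (Fin 2) (Fin 2) ℂ)) 0 (fun b' => Complex.I • X b')
                * star ((Averaging.iter (fun i => blockAvg (P := (F.P K)) (j := i) (expMeanLogSU (n := Fin 2))) l W b : Matrix.specialUnitaryGroup (Fin 2) ℂ) : Matrix (Fin 2) (Fin 2) ℂ)‖
              ≤ A₂ * (∑ b : PBond (F.P K) 0, ‖X b‖ ^ 2) * ((F.L : ℝ) ^ l)⁻¹
                + (B₂ * ((∑ p : Plaq (F.P K) 0, ‖((Complex.I • X ⟨p.src, p.μ⟩) + ((W ⟨p.src, p.μ⟩ : Matrix (Fin 2) (Fin 2) ℂ) * (Complex.I • X ⟨p.src.shift p.μ, p.ν⟩) * star (W ⟨p.src, p.μ⟩ : Matrix (Fin 2) (Fin 2) ℂ))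
            - (((W ⟨p.src, p.μ⟩ * W ⟨p.src.shift p.μ, p.ν⟩ * (W ⟨p.src.shift p.ν, p.μ⟩)⁻¹ : Matrix.specialUnitaryGroup (Fin 2) ℂ) : Matrix (Fin 2) (Fin 2) ℂ) * (Complex.I • X ⟨p.src.shift p.ν, p.μ⟩) * star ((W ⟨p.src, p.μ⟩ * W ⟨p.src.shift p.μ, p.ν⟩ * (W ⟨p.src.shift p.ν, p.μ⟩)⁻¹ : Matrix.specialUnitaryGroup (Fin 2) ℂ) : Matrix (Fin 2) (Fin 2) ℂ))
            - (((GaugeField.plaqHol W p : Matrix.specialUnitaryGroup (Fin 2) ℂ) : Matrix (Fin 2) (Fin 2) ℂ) * (Complex.I • X ⟨p.src, p.ν⟩) * star ((GaugeField.plaqHol W p : Matrix.specialUnitaryGroup (Fin 2) ℂ) : Matrix (Fin 2) (Fin 2) ℂ)))‖ ^ 2) + (∑ x : Site (F.P K) 0, ∑ j : Fin 2, ∑ k : Fin 2,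
              ‖(divB (torusT (F.P K) 0) (fun κ z => unitsField (toUField W) ⟨z, κ⟩) (fun κ z => Complex.I • X ⟨z, κ⟩) x) j k‖ ^ 2))
                  + B₂' * (((F.L : ℝ) ^ (K - n)) ^ 2)⁻¹ * (∑ b : PBond (F.P K) 0, ‖X b‖ ^ 2)) * (F.L : ℝ) ^ l) :
    ∀ (L : ℕ), 1 < L → ∀ (B₁' : ℝ), 0 < B₁' → ∃ eS Cs₁ Cs₂ : ℝ, 0 < eS ∧ 0 ≤ Cs₁ ∧ 0 ≤ Cs₂ ∧
      ∀ (F : T3Family), F.L = L → ∀ (n K : ℕ) (hnK : n < K) (e : ℝ) (V : GaugeField (F.P n) 0 (Matrix.specialUnitaryGroup (Fin 2) ℂ))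
        (W : GaugeField (F.P K) 0 (Matrix.specialUnitaryGroup (Fin 2) ℂ)) (X : PBond (F.P K) 0 → Matrix (Fin 2) (Fin 2) ℂ),
        0 < e → e ≤ eS → W ∈ regFibrePr F n K hnK.le e V →
        (∀ γ : ℝ → GaugeField (F.P K) 0 (Matrix.specialUnitaryGroup (Fin 2) ℂ), γ 0 = W → (∀ t, γ t ∈ fibre F ℰp n K hnK.le V) →
          (∀ b, DifferentiableAt ℝ (fun t => ((γ t b : Matrix.specialUnitaryGroup (Fin 2) ℂ) : Matrix (Fin 2) (Fin 2) ℂ)) 0) →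
            deriv (fun t => wilsonAction4 (γ t)) 0 = 0) →
        In19 F n K (2 * B₁' * e) W (expHermField X) X → AvgCondPrint F n K hnK.le V W X → IsLandauPrint F n K W X →
          ∑ y : Site (F.P n) 0, ‖((frameTwS F n K hnK.le W (fun b => Complex.I • X b) y : (Matrix (Fin 2) (Fin 2) ℂ)ˣ) : Matrix (Fin 2) (Fin 2) ℂ) - 1
            - fderiv ℂ (fun A : PBond (F.P K) 0 → Matrix (Fin 2) (Fin 2) ℂ => ((frameTwS F n K hnK.le W A y : (Matrix (Fin 2) (Fin 2) ℂ)ˣ) : Matrix (Fin 2) (Fin 2) ℂ)) 0 (fun b => Complex.I • X b)‖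
            ≤ Cs₁ * ((F.L : ℝ) ^ (K - n))⁻¹ * (∑ b : PBond (F.P K) 0, ‖X b‖ ^ 2) + Cs₂ * ((F.L : ℝ) ^ (K - n)) * ((∑ p : Plaq (F.P K) 0, ‖((Complex.I • X ⟨p.src, p.μ⟩) + ((W ⟨p.src, p.μ⟩ : Matrix (Fin 2) (Fin 2) ℂ) * (Complex.I • X ⟨p.src.shift p.μ, p.ν⟩) * star (W ⟨p.src, p.μ⟩ : Matrix (Fin 2) (Fin 2) ℂ))
            - (((W ⟨p.src, p.μ⟩ * W ⟨p.src.shift p.μ, p.ν⟩ * (W ⟨p.src.shift p.ν, p.μ⟩)⁻¹ : Matrix.specialUnitaryGroup (Fin 2) ℂ) : Matrix (Fin 2) (Fin 2) ℂ) * (Complex.I • X ⟨p.src.shift p.ν, p.μ⟩) * star ((W ⟨p.src, p.μ⟩ * W ⟨p.src.shift p.μ, p.ν⟩ * (W ⟨p.src.shift p.ν, p.μ⟩)⁻¹ : Matrix.specialUnitaryGroup (Fin 2) ℂ) : Matrix (Fin 2) (Fin 2) ℂ))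
            - (((GaugeField.plaqHol W p : Matrix.specialUnitaryGroup (Fin 2) ℂ) : Matrix (Fin 2) (Fin 2) ℂ) * (Complex.I • X ⟨p.src, p.ν⟩) * star ((GaugeField.plaqHol W p : Matrix.specialUnitaryGroup (Fin 2) ℂ) : Matrix (Fin 2) (Fin 2) ℂ)))‖ ^ 2) + (∑ x : Site (F.P K) 0, ∑ j : Fin 2, ∑ k : Fin 2,
              ‖(divB (torusT (F.P K) 0) (fun κ z => unitsField (toUField W) ⟨z, κ⟩) (fun κ z => Complex.I • X ⟨z, κ⟩) x) j k‖ ^ 2)) := by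
  intro L hL B₁' hB₁'
  obtain ⟨e₂, A₂, B₂, B₂', he₂, hA₂, hB₂, hB₂', hNL⟩ := hN2s L hL B₁' hB₁'
  have hL0 : (0 : ℝ) < (L : ℝ) := by exact_mod_cast (show 0 < L by omega)
  obtain ⟨T, hT_def⟩ : ∃ T : ℝ, T = 100000000000000 * (L : ℝ) ^ 9 + 400000000000 * (L : ℝ) ^ 9 * (2 * B₁') := ⟨_, rfl⟩
  have t1 : (0 : ℝ) ≤ 100000000000000 * (L : ℝ) ^ 9 := by positivity
  have t2 : (0 : ℝ) ≤ 400000000000 * (L : ℝ) ^ 9 * (2 * B₁') := by positivity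
  have hTpos : 0 < T := by rw [hT_def]; positivity
  obtain ⟨σ, hσ_def⟩ : ∃ σ : ℝ, σ = (400000000000 * (L : ℝ) ^ 9)⁻¹ := ⟨_, rfl⟩
  have hc0 : (0 : ℝ) < 400000000000 * (L : ℝ) ^ 9 := by positivity
  have hσ0 : 0 ≤ σ := by rw [hσ_def]; positivity
  refine ⟨min e₂ T⁻¹,
    (1 * (2 * (L : ℝ) * (7 * (9 * (L : ℝ) ^ 2 / 2 + 171 * (L : ℝ) ^ 2) + 50960 * (L : ℝ) ^ 3) + 2 / (L : ℝ) * ((((9 * (L : ℝ) ^ 2 / 2 + 171 * (L : ℝ) ^ 2) + 3640 * (L : ℝ) ^ 2) * (28800 * (L : ℝ) ^ 4) * ((L : ℝ) / 2)) * (384 + 60 * σ ^ 2) + (((9 * (L : ℝ) ^ 2 / 2 + 171 * (L : ℝ) ^ 2) + 3640 * (L : ℝ) ^ 2) * (600000 * (L : ℝ) ^ 4) * ((L : ℝ) / 2))))) + 3 * (L : ℝ) ^ 2 * A₂ + 3 * (L : ℝ) / 2 * B₂',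
    (1 * (2 / (L : ℝ) * (8 * (((9 * (L : ℝ) ^ 2 / 2 + 171 * (L : ℝ) ^ 2) + 3640 * (L : ℝ) ^ 2) * (28800 * (L : ℝ) ^ 4) * ((L : ℝ) / 2))))) + 3 * (L : ℝ) / 2 * B₂,
    lt_min he₂ (inv_pos.mpr hTpos), by positivity, by positivity, ?_⟩
  intro F hF n K hnK e V W X he heS hWreg hEL h19 h20 h21
  have he₂' : e ≤ e₂ := heS.trans (min_le_left _ _)
  have heT : e ≤ T⁻¹ := heS.trans (min_le_right _ _)
  have hTe : T * e ≤ 1 := by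
    calc T * e ≤ T * T⁻¹ := mul_le_mul_of_nonneg_left heT hTpos.le
      _ = 1 := mul_inv_cancel₀ hTpos.ne'
  have w1 : 100000000000000 * (L : ℝ) ^ 9 * e ≤ 1 := summand_window (by rw [hT_def]; linarith) he.le hTe
  have w3 : 400000000000 * (L : ℝ) ^ 9 * (2 * B₁') * e ≤ 1 := summand_window (by rw [hT_def]; linarith) he.le hTe
  have hNM := hNL F hF n K hnK e V W X he he₂' hWreg hEL h19 h20 h21
  subst hF
  obtain ⟨-, hreg⟩ := (mem_regFibrePr_iff F).mp hWreg
  have hη : eta F n K = ((F.L : ℝ) ^ (K - n))⁻¹ := by rw [eta, inv_pow]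
  have hD : ∀ b : PBond (F.P K) 0, (X b).IsHermitian ∧ Matrix.trace (X b) = 0 := h19.1
  have hσL : 400000000000 * (F.L : ℝ) ^ 9 * σ ≤ 1 := by rw [hσ_def, mul_inv_cancel₀ hc0.ne']
  have hsmallσ : 2 * B₁' * e ≤ σ := by
    have hrew : 2 * B₁' * e = σ * (400000000000 * (F.L : ℝ) ^ 9 * (2 * B₁') * e) := by
      rw [hσ_def]; field_simp
    rw [hrew]
    exact mul_le_of_le_one_right hσ0 w3
  have hs : ∀ b : PBond (F.P K) 0, ‖X b‖ ≤ σ * ((F.L : ℝ) ^ (K - n))⁻¹ := by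
    intro b
    have hb := (h19.2.2.1 b).le
    rw [hη] at hb
    exact hb.trans (mul_le_mul_of_nonneg_right hsmallσ (by positivity))
  exact sum_norm_frameTwS_sub_one_sub_fderiv_le_X_of_N2 F n K hnK.le he w1 hσ0 hσL W hreg X hD hs hA₂ hB₂ hB₂' hNM

-- KERNEL WITNESS (no new content): the conclusion IS ✓p705268's `hRs` slot — `hD` from `hMc`, «(n3)₂-sym», «REM2ᶜ» as typed.
example := fun hMc hN2s hRc => Prop7HDOfCombRowRem2Rows.hD_of_hMcomb_of_rem2Rows hMc (hRs_of_hN2s hN2s) hRc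

end Summit.QuantumFields.YangMills.Theorems.Prop7SymFrameRem2RowOfN32Sym

end
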